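import Mathlib.LinearAlgebra.Matrix.NonsingularInverse
import Literature.MathematicalPhysics.QuantumFieldTheory.YangMillsEuclidean
import Literature.MathematicalPhysics.QuantumLattice.GrassmannIntegral
import HarnessLib

/-!
# QCD: `SU(3)` Yang–Mills with `N_f` fundamental Wilson–Dirac fermions — existence and mass gap

Trunk T-AQFT (Literature/MathematicalPhysics/QuantumFieldTheory); definition request `defn-QCD`,
conjunct `QCD` of the tier-1 summit `QuantumFields := YangMills ∧ QCD` (D-0013).

## Informal content

"`SU(3)` Yang–Mills minimally coupled to `N_f` flavours of fundamental Dirac fermions (fixed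
`N_f`, massive quarks) exists in the same axiomatic sense as Clay Yang–Mills — a continuum limit
`a → 0` of the lattice theory satisfying the Osterwalder–Schrader axioms — and has a mass gap"
(Jaffe–Witten, *Quantum Yang–Mills theory* (2000), §1 and §6 (comments on QCD, chiral symmetry
breaking, existence of a mass gap for massive quarks); Wilson, Phys. Rev. D 10 (1974) 2445 (lattice
gauge theory with quarks); Montvay–Münster, *Quantum fields on a lattice* (1994), §4.2 (Wilson
fermions), §5.1 (lattice QCD action, fermion determinant, meson correlators); Seiler, LNP 159
(1982), Ch. 3 (gauge theories with fermions, OS positivity of Wilson fermions); Osterwalder–Seiler,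
Ann. Phys. 110 (1978) 440).

## How H21 renders it (same pattern as `ClayYangMillsEuclidean`, torus-primary)

* **Lattice QCD measure.** On the four-torus of side `L`, gauge group `SU(3)` in the fundamental
  representation, the fermions (Grassmann variables `ψ̄, ψ` indexed by site × colour × spin, one
  copy per flavour `f`, Wilson parameter `r = 1`, bare masses `m_f`) are integrated out exactly by
  the Gaussian Berezin formula (`GrassmannIntegral.lean`), leaving the positive measure
  `Z⁻¹ e^{-β S_W(U)} ∏_f |det D_W(U, m_f)| ∏_e dU_e` on gauge fields (`qcdLatticeMeasure`; `|det|`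
  as in the tree's `qedLatticeMeasure` — `det D_W` is real by `γ₅`-hermiticity and positive for
  degenerate pairs / large enough masses; recorded deviation).
* **Gluonic sector.** The smeared renormalised plaquette field (`plaquetteObservable`, the local
  gauge-invariant field `tr F²` of Chatterjee's Problem 5.1) under these *unquenched* measures along
  a scaling scheme (`β(a)`, bare masses `m_f(a)`, renormalisations, tori of physical side `→ ∞`)
  converges in law to a probability measure `μ` on `𝒮'(ℝ⁴)` which is an OS measure, non-Gaussian,
  with exponential clustering (mass gap `m > 0`).
* **Quark sector (non-decoupling and gap in the meson channel).** Fermionic composite fields are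
  not random variables of `μ`; their Schwinger functions are integrals of Wick contractions of quark
  propagators `G_U = D_W(U)⁻¹` against the effective gauge measure. The flavour non-singlet
  pseudoscalar ("pion") two-point function `⟨(ψ̄_{f₂} γ₅ ψ_{f₁})(x) (ψ̄_{f₁} γ₅ ψ_{f₂})(y)⟩ =
  -∫ tr[G_{f₁}(x,y) γ₅ G_{f₂}(y,x) γ₅] dμ_QCD(U)` (`pionCorrelator`, Montvay–Münster §5.1.6) is smeared
  and rescaled (`pionTwoPoint`); the statement asks that it converge as `a → 0⁺` to a continuum
  two-point function `S_π` which (i) is NOT a pure contact term (nonzero on some pair of test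
  functions with disjoint supports — this excludes the trivial "infinitely heavy, decoupled quarks"
  scheme under which the gluonic clauses alone would follow from pure Yang–Mills) and (ii) clusters
  exponentially at some rate `m_π > 0` (mass gap in the meson channel; forces massive quarks —
  massless quarks would give Goldstone pions).

## Contents

* `SU3`, `qcdLatticeWeight`, `qcdLatticeMeasure`, `quarkPropagator`, `pionContraction`,
  `pionCorrelator` (finite lattice, honest integrals);
* `QCDScalingScheme Nf` (extends `ScalingScheme` by bare masses `mq f a` and the pion field
  renormalisation `cπ a`), `qcdTorusSmearedLaw`, `pionTwoPoint`;
* `QCDWith Nf : Prop` and the conjunct `QCD : Prop := ∀ N_f ∈ [2, 6], QCDWith N_f`.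

## Design choices

* Everything specialised to `d = 4`, `G = SU(3)`, fundamental representation, Wilson fermions
  with `r = 1` (the tree's `wilsonDirac`); staggered fermions would be an inequivalent
  regularisation of the same conjectural continuum theory.
* Bare quark masses are functions of `a` in the scheme (Wilson fermions need additive mass
  renormalisation); "massive quarks" is not an input but is enforced by the conclusions (finite,
  nonzero meson correlation length).
* `QCD` fixes the physically relevant range `2 ≤ N_f ≤ 6` (at least two flavours so that flavour
  non-singlet mesons exist; at most the six known quarks; all asymptotically free). `QCDWith N_f`
  is available for other `N_f`.
* Junk values: `Matrix.inv` of a singular Dirac operator is `0`; `qcdLatticeMeasure` is junk if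
  the weight has zero or infinite mass (does not happen for `L ≥ 1`); Bochner integrals of
  non-integrable functions are `0`. None affects the (existential) statement's meaning: a witness
  scheme must produce genuine limits.
* Mathlib has no lattice gauge theory / OS axioms; all vocabulary is the tree's
  (`YangMillsEuclidean.lean`, `ContinuumLimitLGT.lean`, `OSAxiomsMeasure.lean`,
  `GrassmannIntegral.lean`).
-/

noncomputable section

open scoped SchwartzMap
open MeasureTheory Filter Topology
open Literature.MathematicalPhysics.QuantumLattice Literature.Probability.LatticeModels

namespace Literature.MathematicalPhysics.QuantumFieldTheory

/-- The colour gauge group `SU(3)` (Mathlib's `Matrix.specialUnitaryGroup (Fin 3) ℂ`).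
[Wilson 1974, §III] [folklore] -/
abbrev SU3 : Type := Matrix.specialUnitaryGroup (Fin 3) ℂ

/-- The index type of one flavour of lattice quark fields on the four-torus of side `L`:
site × colour × Dirac spin (the index of the tree's `wilsonDirac` with `N = 3`).
[Montvay–Münster 1994, §4.2] [folklore] -/
abbrev QuarkIdx (L : ℕ) : Type := TorusSite 4 L × Fin 3 × Fin 4

/-! ### Lattice QCD on the four-torus -/

section Lattice

variable (L : ℕ) [NeZero L]

/-- The un-normalised lattice QCD weight on the four-torus of side `L`: Wilson gauge weight for
`SU(3)` (fundamental representation) at inverse coupling `β`, times the Wilson-fermion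
determinants of `N_f` flavours with bare masses `mq f` (`r = 1`), fermions integrated out:
`e^{-β S_W(U)} ∏_f |det D_W(U, m_f, 1)| ∏_e dU_e`. [Montvay–Münster 1994, §5.1 (effective gauge
action with fermion determinant); Wilson 1974] [cite: MontvayMunster1994, §5.1] -/
def qcdLatticeWeight (β : ℝ) {Nf : ℕ} (mq : Fin Nf → ℝ) : Measure (GaugeConfig 4 L SU3) :=
  (wilsonWeight (d := 4) (L := L) (fundamentalRep (Fin 3)) β).withDensity fun U =>
    ENNReal.ofReal (∏ f, ‖fermionDet (wilsonDirac (fundamentalRep (Fin 3)) U (mq f) 1)‖)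

/-- The lattice QCD probability measure `Z⁻¹ e^{-β S_W(U)} ∏_f |det D_W(U, m_f)| ∏_e dU_e` on
`SU(3)` gauge configurations of the four-torus (junk: not a probability measure if the weight
has zero or infinite total mass, which does not happen for `L ≥ 1`).
[Montvay–Münster 1994, §5.1; Seiler 1982, Ch. 3] [cite: MontvayMunster1994, §5.1] -/
def qcdLatticeMeasure (β : ℝ) {Nf : ℕ} (mq : Fin Nf → ℝ) : Measure (GaugeConfig 4 L SU3) :=
  (qcdLatticeWeight L β mq Set.univ)⁻¹ • qcdLatticeWeight L β mq

variable {L}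

/-- The Wilson quark propagator `G_U = D_W(U, m, 1)⁻¹` in the background gauge field `U`
(Mathlib `Matrix.inv`; junk `0` if `D_W` is singular). [Montvay–Münster 1994, §4.2 and §5.1.6
(quark propagator)] [cite: MontvayMunster1994, §5.1] -/
def quarkPropagator (U : GaugeConfig 4 L SU3) (m : ℝ) : Matrix (QuarkIdx L) (QuarkIdx L) ℂ :=
  (wilsonDirac (fundamentalRep (Fin 3)) U m 1)⁻¹

/-- The pseudoscalar (pion) Wick contraction in the background `U` for quark masses `m₁, m₂`:
`C_U(x, y) = tr_{colour, spin} [G_{m₁}(x, y) γ₅ G_{m₂}(y, x) γ₅]`.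
[Montvay–Münster 1994, §5.1.6 (meson correlation functions)] [cite: MontvayMunster1994, §5.1] -/
def pionContraction (U : GaugeConfig 4 L SU3) (m₁ m₂ : ℝ) (x y : TorusSite 4 L) : ℂ :=
  ∑ a : Fin 3, ∑ b : Fin 3, ∑ α : Fin 4, ∑ β : Fin 4, ∑ α' : Fin 4, ∑ β' : Fin 4,
    quarkPropagator U m₁ (x, a, α) (y, b, β) * gammaFive β β' *
      quarkPropagator U m₂ (y, b, β') (x, a, α') * gammaFive α' α

variable (L)

/-- The lattice pion two-point Schwinger function of flavours `f₁ ≠ f₂`: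
`S_π(x, y) = ⟨(ψ̄_{f₂} γ₅ ψ_{f₁})(x) (ψ̄_{f₁} γ₅ ψ_{f₂})(y)⟩ = -∫ C_U(x, y) dμ_QCD(U)` (one fermion
loop, sign `-1`; the fermionic expectation is the Berezin integral, evaluated by Wick's theorem).
[Montvay–Münster 1994, §5.1.6; Seiler 1982, Ch. 3] [cite: MontvayMunster1994, §5.1] -/
def pionCorrelator (β : ℝ) {Nf : ℕ} (mq : Fin Nf → ℝ) (f₁ f₂ : Fin Nf) (x y : TorusSite 4 L) : ℂ :=
  -∫ U, pionContraction U (mq f₁) (mq f₂) x y ∂(qcdLatticeMeasure L β mq)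

end Lattice

/-! ### Scaling schemes and continuum objects -/

/-- A scaling scheme for lattice QCD with `N_f` flavours: a gauge scaling scheme (`β(a)`, plaquette
field renormalisations `c(a)`, `m(a)`, torus half-side `L(a)` with `a L(a) → ∞`) together with
the bare quark masses `mq f a` (in lattice units; Wilson fermions require `a`-dependent additive
mass renormalisation) and the multiplicative renormalisation `cπ a` of the pion field.
[Montvay–Münster 1994, §5.1 (hopping parameter / bare mass tuning); Jaffe–Witten 2000, §6] [cite: MontvayMunster1994, §5.1] -/
structure QCDScalingScheme (Nf : ℕ) extends ScalingScheme where
  /-- bare quark mass of flavour `f` at spacing `a`, in lattice units -/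
  mq : Fin Nf → ℝ → ℝ
  /-- multiplicative renormalisation of the pseudoscalar density -/
  cπ : ℝ → ℝ

variable {Nf : ℕ}

/-- The law at spacing `a` of the smeared rescaled local gauge-invariant field `O` under the
lattice QCD measure of the scheme (torus of side `2 L(a) + 1`, configurations lifted periodically
to `ℤ⁴` and smeared over the fundamental domain `box 4 (L a)`), a measure on `𝒮'(ℝ⁴)`; the QCD
analogue of `torusSmearedLaw`. [Chatterjee arXiv:1803.01950, §5; Jaffe–Witten 2000, §6] [cite: arXiv180301950, §5] -/
def qcdTorusSmearedLaw (sch : QCDScalingScheme Nf) (O : LocalGaugeObservable 4 SU3) (a : ℝ) :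
    Measure (FieldConfig (EuclideanSpace ℝ (Fin 4))) :=
  (qcdLatticeMeasure (sch.side a) (sch.β a) fun f => sch.mq f a).map
    (smearedGaugeField O (box 4 (sch.L a)) a (sch.c a) (sch.m a) ∘ torusLift (sch.side a))

/-- The smeared, rescaled lattice pion two-point function at spacing `a`:
`S_π^{(a)}(f, g) = cπ(a)² a⁸ Σ_{x, y ∈ box} f(a x) g(a y) S_π(x mod side, y mod side)`.
[Montvay–Münster 1994, §5.1.6; Glimm–Jaffe 1987, §6.1 (smeared Schwinger functions)] [cite: MontvayMunster1994, §5.1] -/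
def pionTwoPoint (sch : QCDScalingScheme Nf) (f₁ f₂ : Fin Nf) (a : ℝ)
    (f g : 𝓢(EuclideanSpace ℝ (Fin 4), ℝ)) : ℂ :=
  ((sch.cπ a) ^ 2 * a ^ 8 : ℝ) *
    ∑ x ∈ box 4 (sch.L a), ∑ y ∈ box 4 (sch.L a),
      (f (a • siteToE x) * g (a • siteToE y) : ℝ) *
        pionCorrelator (sch.side a) (sch.β a) (fun f => sch.mq f a) f₁ f₂
          (Torus.proj (sch.side a) x) (Torus.proj (sch.side a) y)

/-! ### The statements -/

/-- **`QCDWith N_f`**: Euclidean lattice-to-continuum existence of `SU(3)` gauge theory with `N_f`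
flavours of fundamental Wilson–Dirac quarks, with a mass gap, torus-primary form. There are a QCD
scaling scheme `sch`, a probability measure `μ` on `𝒮'(ℝ⁴)` and continuum pion two-point
functions `S_π f₁ f₂` such that:
* (gluons) the smeared renormalised plaquette fields under the unquenched lattice QCD measures
  converge in law to `μ` as `a → 0⁺`; `μ` satisfies the Osterwalder–Schrader axioms
  (`IsOSMeasure`), is non-Gaussian, and has exponential clustering at some rate `m > 0`;
* (quarks) for all flavours `f₁ ≠ f₂` and test functions, the smeared lattice pion two-point
  functions converge to `S_π f₁ f₂ f g`; `S_π f₁ f₂` is not a pure contact term (nonzero on some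
  `f, g` with disjoint supports — quarks are dynamical, not decoupled); and there is `m_π > 0` with
  `|S_π f₁ f₂ f (T_t g)| ≤ C e^{-m_π t}` for `θf`, `g` positive-time (mass gap in the meson channel).
[Jaffe–Witten 2000, §1, §6 (QCD, mass gap with massive quarks); Wilson 1974; Montvay–Münster 1994,
§5.1; Osterwalder–Seiler 1978 (OS positivity of lattice gauge theories with fermions)] [cite: JaffeWitten2000, §6] -/
def QCDWith (Nf : ℕ) : Prop :=
  ∃ (sch : QCDScalingScheme Nf) (μ : Measure (FieldConfig (EuclideanSpace ℝ (Fin 4))))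
    (Sπ : Fin Nf → Fin Nf → 𝓢(EuclideanSpace ℝ (Fin 4), ℝ) → 𝓢(EuclideanSpace ℝ (Fin 4), ℝ) → ℂ),
    -- gluonic sector
    IsProbabilityMeasure μ ∧
      TendstoInLaw (qcdTorusSmearedLaw sch
        (plaquetteObservable (fundamentalRep (Fin 3)) (continuous_fundamentalRep (Fin 3)) 0 1))
        (𝓝[>] 0) μ ∧
      IsOSMeasure 4 μ ∧ IsNonGaussian μ ∧ (∃ m > 0, HasExponentialClustering 4 μ m) ∧
    -- quark sector
    (∀ f₁ f₂ : Fin Nf, f₁ ≠ f₂ → ∀ f g,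
        Tendsto (fun a => pionTwoPoint sch f₁ f₂ a f g) (𝓝[>] 0) (𝓝 (Sπ f₁ f₂ f g))) ∧
    (∀ f₁ f₂ : Fin Nf, f₁ ≠ f₂ → ∃ f g : 𝓢(EuclideanSpace ℝ (Fin 4), ℝ),
        Disjoint (tsupport (f : EuclideanSpace ℝ (Fin 4) → ℝ))
          (tsupport (g : EuclideanSpace ℝ (Fin 4) → ℝ)) ∧ Sπ f₁ f₂ f g ≠ 0) ∧
    ∃ mπ > 0, ∀ f₁ f₂ : Fin Nf, f₁ ≠ f₂ → ∀ f g : 𝓢(EuclideanSpace ℝ (Fin 4), ℝ),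
      IsPositiveTime (thetaTest 4 f) → IsPositiveTime g →
        ∃ C : ℝ, ∀ t : ℝ, 0 ≤ t → ‖Sπ f₁ f₂ f (timeShiftTest 4 t g)‖ ≤ C * Real.exp (-mπ * t)

/-- **QCD** (conjunct of the summit `QuantumFields`): for every number of flavours
`2 ≤ N_f ≤ 6`, `SU(3)` Yang–Mills theory minimally coupled to `N_f` fundamental Dirac fermions
exists as an Osterwalder–Schrader continuum limit of lattice QCD and has a mass gap, in both the
gluonic and the (massive-quark) meson channel — `QCDWith N_f`. Open problem: `def … : Prop`
only. [Jaffe–Witten 2000, §1 and §6; Wilson 1974] [cite: JaffeWitten2000, §6] -/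
def QCD : Prop :=
  ∀ Nf : ℕ, 2 ≤ Nf → Nf ≤ 6 → QCDWith Nf

/-! ### API -/

/-- Unfolding `QCD`. [Jaffe–Witten 2000, §6] [folklore] -/
theorem qcd_iff : QCD ↔ ∀ Nf : ℕ, 2 ≤ Nf → Nf ≤ 6 → QCDWith Nf := Iff.rfl

/-- `QCD` yields two-flavour QCD. [folklore] -/
theorem QCD.two (h : QCD) : QCDWith 2 := h 2 le_rfl (by norm_num)

/-- The gluonic part of `QCDWith`: an OS measure with a mass gap arising from unquenched lattice
QCD. [Jaffe–Witten 2000, §6] [folklore] -/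
theorem QCDWith.exists_isOSMeasure {Nf : ℕ} (h : QCDWith Nf) :
    ∃ (sch : QCDScalingScheme Nf) (μ : Measure (FieldConfig (EuclideanSpace ℝ (Fin 4)))),
      TendstoInLaw (qcdTorusSmearedLaw sch
        (plaquetteObservable (fundamentalRep (Fin 3)) (continuous_fundamentalRep (Fin 3)) 0 1))
        (𝓝[>] 0) μ ∧ IsOSMeasure 4 μ ∧ ∃ m > 0, HasExponentialClustering 4 μ m := by
  obtain ⟨sch, μ, -, -, hlaw, hOS, -, hgap, -⟩ := h
  exact ⟨sch, μ, hlaw, hOS, hgap⟩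

/-- Unfolding the lattice pion correlator (an honest integral against `qcdLatticeMeasure`).
[Montvay–Münster 1994, §5.1.6] [folklore] -/
theorem pionCorrelator_def {L : ℕ} [NeZero L] (β : ℝ) {Nf : ℕ} (mq : Fin Nf → ℝ) (f₁ f₂ : Fin Nf)
    (x y : TorusSite 4 L) :
    pionCorrelator L β mq f₁ f₂ x y =
      -∫ U, pionContraction U (mq f₁) (mq f₂) x y ∂(qcdLatticeMeasure L β mq) := rfl

/-- With no flavours the fermion determinant is an empty product and the lattice QCD weight is the
pure Wilson `SU(3)` weight (quenched = pure gauge). [Montvay–Münster 1994, §5.1] [folklore] -/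
theorem qcdLatticeWeight_zero_flavours (L : ℕ) [NeZero L] (β : ℝ) (mq : Fin 0 → ℝ) :
    qcdLatticeWeight L β mq = wilsonWeight (d := 4) (L := L) (fundamentalRep (Fin 3)) β := by
  simp [qcdLatticeWeight]

end Literature.MathematicalPhysics.QuantumFieldTheory
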